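import Mathlib
import Summits.CriticalPhenomena.CardyFormulaZ2.Theorems.CardyMagicRigidityNestingRigidityUVFarBiteScales
import HarnessLib

/-!
# Crux `NestingRigidity`, line `positive-cone-weight-doubling`: the MULTI-SCALE BRICK — all-order
# centred exponential moments of additive statistics of the loops inside a bounded region

Crux `Summit.CriticalPhenomena.CardyFormulaZ2.Theses.CardyMagicRigidity.NestingRigidity`
(stmt-CriticalPhenomena-4835), line `positive-cone-weight-doubling`, registered helper Ξ
`uvFarBite_expMoment_latticeEnsembles`.  This file assembles the generic brick behind Ξ (and behind
every "UV loops bite little but are many" estimate of the line; registered anchor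
`expMoment_centred_finsum_inner_le_latticeEnsembles`): for `E ∈ latticeEnsembles`, given the K6
bound at all centres and scales (order `A + 1`, constant `K`, threshold `c₀`) and the microscopic
count bound `M` (radius `12 c₀ δ`), there is ONE constant `C` such that for every region
`D ⊆ B(x₀, ρ)`, every weight `g` with `|g u| ≤ κ diam(u)²` on the loops inside `D`, every order `a`
with `1152 |a| κ ρ² ≤ A` and every mesh `0 < δ ≤ ρ`, the additive statistic
`S = Σ_{u ∈ X_δ, trace u ⊆ D} g u` has `E_δ exp(a (S − E_δ S)) ≤ C` — both tails, uniformly in the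
region, the mesh and the scale `ρ`.

Proof (no cited fact, no definition): `S − E S = Σ_k Z_k + Z_μ` over the K6 scales `h_k = 4ρ 2^{-k}`,
`k < n` (`4 c₀ δ < h_k`) and the microscopic scale (diameters `< h_n ≤ 4 c₀ δ`); the pieces
`UVFarBite.scalePiece` / `UVFarBite.microPiece` (…UVFarBiteScales) bound `E e^{Z_k / w_k}` with
`w_{k} = 2^{-k-3}`, `w_μ = 1/2`, and `expMoment_scaleSum_le_latticeEnsembles` assembles:
`log C = 576 (A/1152)² c₀² (2+8c₀)² e^{2(c₀²A/4+1)M} + A² K²/2`.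
-/

noncomputable section

open MeasureTheory ProbabilityTheory Set Filter Metric
open scoped Real Topology BigOperators

namespace Summit.CriticalPhenomena.CardyFormulaZ2.Cruxes.NestingRigidity.PositiveConeWeightDoubling

open Literature.Probability.RandomPlanarGeometry Literature.Probability.Percolation
  Literature.Probability.LatticeModels
open Summit.CriticalPhenomena.CardyFormulaZ2.Cruxes.NestingRigidity.RingCloudTomography

/-- Abscissa of the left edge of the bounding box of a loop (local notation, as in …UVFarBiteCells). -/
local notation3 "XI[" u "]" => sInf (Complex.re '' UnbasedLoop.range u)
/-- Ordinate of the bottom edge of the bounding box of a loop (local notation). -/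
local notation3 "YI[" u "]" => sInf (Complex.im '' UnbasedLoop.range u)
/-- The grid cell (side `h`) containing the lower-left corner of the bounding box (local notation). -/
local notation3 "IDX[" h ", " u "]" => ((⌊XI[u] / h⌋, ⌊YI[u] / h⌋) : ℤ × ℤ)
/-- The doubled cell `[ih, (i+2)h] × [jh, (j+2)h]` of the grid cell `c = (i, j)` (local notation). -/
local notation3 "BOX[" h ", " c "]" => {z : ℂ | ((Prod.fst c : ℤ) : ℝ) * h ≤ z.re ∧
  z.re ≤ (((Prod.fst c : ℤ) : ℝ) + 2) * h ∧ ((Prod.snd c : ℤ) : ℝ) * h ≤ z.im ∧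
  z.im ≤ (((Prod.snd c : ℤ) : ℝ) + 2) * h}
/-- The centre `((i+1)h, (j+1)h)` of the doubled cell (local notation). -/
local notation3 "CTR[" h ", " c "]" =>
  (Complex.mk ((((Prod.fst c : ℤ) : ℝ) + 1) * h) ((((Prod.snd c : ℤ) : ℝ) + 1) * h) : ℂ)
/-- The cells that loops inside `B(x₀, ρ)` can be assigned to (local notation). -/
local notation3 "RNG[" h ", " x₀ ", " ρ "]" => (Finset.Icc ⌊(Complex.re x₀ - ρ) / h⌋ ⌊(Complex.re x₀ + ρ) / h⌋ ×ˢ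
  Finset.Icc ⌊(Complex.im x₀ - ρ) / h⌋ ⌊(Complex.im x₀ + ρ) / h⌋ : Finset (ℤ × ℤ))

set_option maxHeartbeats 400000 in
/-- **The multi-scale brick: all-order CENTRED exponential moments of additive statistics of the
loops inside a bounded region, both lattice ensembles** (registered helper toward Ξ
`uvFarBite_expMoment_latticeEnsembles`, line `positive-cone-weight-doubling`).  For
`E ∈ latticeEnsembles` and constants `A K c₀ M` (`c₀ ≥ 1`) such that (K6 at all centres/scales)
`E_δ exp((A+1) · #{u ∈ X_δ : trace ⊆ B(x, 6l), diam ≥ l}) ≤ K` for all `x`, `l > 0`, `c₀δ ≤ l`, and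
(microscopic count) `#{u ∈ X_δ : trace ⊆ B(x, 12 c₀ δ)} ≤ M` always: there is `C` such that for
every centre `x₀`, scale `ρ > 0`, `κ ≥ 0`, order `a` with `1152 |a| κ ρ² ≤ A`, mesh `0 < δ ≤ ρ`, region
`D ⊆ B(x₀, ρ)` and weight `g` with `|g u| ≤ κ diam(trace u)²` for the loops inside `D`, the statistic
`S = Σ_{u ∈ X_δ, trace u ⊆ D} g u` satisfies `E_δ exp(a (S − E_δ S)) ≤ C` (integrability included). -/
theorem expMoment_centred_finsum_inner_le_latticeEnsembles : ∀ E ∈ latticeEnsembles,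
    ∀ (A K c₀ : ℝ) (M : ℕ), 1 ≤ c₀ →
    (∀ (x : ℂ) (l δ : ℝ), 0 < l → 0 < δ → c₀ * δ ≤ l * 1 →
      Integrable (fun ω ↦ Real.exp ((A + 1) * ({u ∈ (E.X δ ω).loops |
        u.range ⊆ Metric.ball x (l * 6) ∧ l * 1 ≤ Metric.diam u.range}.ncard : ℝ))) E.P ∧
      ∫ ω, Real.exp ((A + 1) * ({u ∈ (E.X δ ω).loops |
        u.range ⊆ Metric.ball x (l * 6) ∧ l * 1 ≤ Metric.diam u.range}.ncard : ℝ)) ∂E.P ≤ K) →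
    (∀ (δ : ℝ), 0 < δ → ∀ (x : ℂ) (ω : E.Ω),
      {u ∈ (E.X δ ω).loops | u.range ⊆ Metric.ball x (12 * c₀ * δ)}.Finite ∧
        {u ∈ (E.X δ ω).loops | u.range ⊆ Metric.ball x (12 * c₀ * δ)}.ncard ≤ M) →
    ∃ C : ℝ, ∀ (x₀ : ℂ) (ρ κ a δ : ℝ) (D : Set ℂ) (g : UnbasedLoop ℂ → ℝ), 0 < ρ → 0 ≤ κ → 0 < δ →
      δ ≤ ρ → D ⊆ Metric.ball x₀ ρ →
      (∀ u : UnbasedLoop ℂ, u.range ⊆ D → |g u| ≤ κ * Metric.diam u.range ^ 2) →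
      1152 * |a| * κ * ρ ^ 2 ≤ A →
      Integrable (fun ω ↦ Real.exp (a * ((∑ᶠ u ∈ {u ∈ (E.X δ ω).loops | u.range ⊆ D}, g u) -
        ∫ ω', (∑ᶠ u ∈ {u ∈ (E.X δ ω').loops | u.range ⊆ D}, g u) ∂E.P))) E.P ∧
      ∫ ω, Real.exp (a * ((∑ᶠ u ∈ {u ∈ (E.X δ ω).loops | u.range ⊆ D}, g u) -
        ∫ ω', (∑ᶠ u ∈ {u ∈ (E.X δ ω').loops | u.range ⊆ D}, g u) ∂E.P)) ∂E.P ≤ C := by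
  intro E hE A K c₀ M hc₀ hK6 hM
  haveI := isProbabilityMeasure_of_mem hE
  set Kμ : ℝ := Real.exp ((c₀ ^ 2 * A / 4 + 1) * M) with hKμ
  refine ⟨Real.exp (576 * (A / 1152) ^ 2 * (c₀ ^ 2 * (2 + 8 * c₀) ^ 2) * Kμ ^ 2 +
    A ^ 2 * K ^ 2 / 2), ?_⟩
  intro x₀ ρ κ a δ D g hρ hκ hδ hδρ hD hg haA
  have hA0 : 0 ≤ A := le_trans (by positivity) haA
  have haκρ : |a| * κ * ρ ^ 2 ≤ A / 1152 := by rw [le_div_iff₀ (by norm_num)]; linarith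
  -- the top side `H = 4ρ` and the number `n` of K6 scales
  obtain ⟨H, hH⟩ : ∃ H : ℝ, H = 4 * ρ := ⟨_, rfl⟩
  have hH0 : 0 < H := by rw [hH]; positivity
  have hex : ∃ n : ℕ, H / 2 ^ n ≤ 4 * c₀ * δ := by
    obtain ⟨n, hn⟩ := exists_pow_lt_of_lt_one (show 0 < 4 * c₀ * δ / H by positivity)
      (show (1 / 2 : ℝ) < 1 by norm_num)
    refine ⟨n, ?_⟩
    calc H / 2 ^ n = H * (1 / 2) ^ n := by rw [one_div_pow, div_eq_mul_one_div]
      _ ≤ H * (4 * c₀ * δ / H) := mul_le_mul_of_nonneg_left hn.le hH0.le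
      _ = 4 * c₀ * δ := mul_div_cancel₀ _ hH0.ne'
  classical
  obtain ⟨n, hn_spec, hn_min⟩ : ∃ n : ℕ, H / 2 ^ n ≤ 4 * c₀ * δ ∧ ∀ k < n, 4 * c₀ * δ < H / 2 ^ k :=
    ⟨Nat.find hex, Nat.find_spec hex, fun k hk ↦ not_le.1 (Nat.find_min hex hk)⟩
  obtain ⟨sμ, hsμ⟩ : ∃ sμ : ℝ, sμ = 4 * c₀ * δ := ⟨_, rfl⟩
  have hs0 : 0 < sμ := by rw [hsμ]; positivity
  have hsρ : sμ ≤ 4 * c₀ * ρ := by rw [hsμ]; gcongr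
  have hnμ : H / 2 ^ n ≤ sμ := hsμ ▸ hn_spec
  -- the cell families of the microscopic scale and of the K6 scales (inner-loop form), kept opaque
  obtain ⟨Yμ, hYμ⟩ : ∃ Yμ : ℤ × ℤ → E.Ω → ℝ, ∀ c ω, Yμ c ω = ∑ᶠ u ∈ {u ∈ (E.X δ ω).loops |
      u.range ⊆ D ∩ BOX[sμ, c] ∧ (diam u.range < H / 2 ^ n ∧ IDX[sμ, u] = c)}, g u :=
    ⟨_, fun _ _ ↦ rfl⟩
  obtain ⟨Ys, hYs⟩ : ∃ Ys : ℕ → ℤ × ℤ → E.Ω → ℝ, ∀ k c ω, Ys k c ω = ∑ᶠ u ∈ {u ∈ (E.X δ ω).loops |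
      u.range ⊆ D ∩ BOX[H / 2 ^ k, c] ∧
        ((H / 2 ^ k / 2 ≤ diam u.range ∧ diam u.range < H / 2 ^ k) ∧ IDX[H / 2 ^ k, u] = c)}, g u :=
    ⟨_, fun _ _ _ ↦ rfl⟩
  -- pointwise decomposition of `S`
  obtain ⟨N₀, hN₀⟩ := BigLoopsBall.exists_ncard_loops_sep_le_ball E hE hδ x₀ ρ
  have hdec : ∀ ω, (∑ᶠ u ∈ {u ∈ (E.X δ ω).loops | u.range ⊆ D}, g u) =
      ∑ c ∈ RNG[sμ, x₀, ρ], Yμ c ω + ∑ k ∈ Finset.range n, ∑ c ∈ RNG[H / 2 ^ k, x₀, ρ], Ys k c ω := by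
    intro ω
    have hB : {u ∈ (E.X δ ω).loops | u.range ⊆ D}.Finite :=
      (hN₀ (fun u ↦ u.range ⊆ D) (fun u h ↦ h.trans hD) ω).1
    have hBball : ∀ u ∈ {u ∈ (E.X δ ω).loops | u.range ⊆ D}, u.range ⊆ ball x₀ ρ :=
      fun u hu ↦ hu.2.trans hD
    have hBH : ∀ u ∈ {u ∈ (E.X δ ω).loops | u.range ⊆ D}, diam u.range < H := fun u hu ↦
      (UVFarBite.diam_le_two_mul hρ.le (hBball u hu)).trans_lt (by rw [hH]; linarith)
    rw [UVFarBite.finsum_mem_eq_micro_add_sum_scales hB hH0 n hBH g]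
    congr 1
    · rw [UVFarBite.finsum_mem_eq_sum_cells (hB.subset fun u hu ↦ hu.1) hs0
        (fun u hu ↦ hBball u hu.1) g]
      refine Finset.sum_congr rfl fun c _ ↦ ?_
      rw [UVFarBite.sep_sep_idx_eq _ D hs0 _ (fun u hu ↦ (le_of_lt hu).trans hnμ) c, hYμ]
    · refine Finset.sum_congr rfl fun k _ ↦ ?_
      have hk' : 0 < H / 2 ^ k := by positivity
      rw [UVFarBite.finsum_mem_eq_sum_cells (hB.subset fun u hu ↦ hu.1) hk'
        (fun u hu ↦ hBball u hu.1) g]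
      refine Finset.sum_congr rfl fun c _ ↦ ?_
      rw [UVFarBite.sep_sep_idx_eq _ D hk' _ (fun u hu ↦ hu.2.le) c, hYs]
  -- integrability and measurability of the families
  have hYμi : ∀ c, Integrable (Yμ c) E.P := fun c ↦ by
    rw [show Yμ c = fun ω ↦ Yμ c ω from rfl]
    simp_rw [hYμ]
    exact UVFarBite.integrable_finsum_inner E hE hδ (D ∩ BOX[sμ, c]) CTR[sμ, c] (3 * sμ) _ g
      (b := κ * sμ ^ 2) (by positivity)
      (Set.inter_subset_right.trans (UVFarBite.cellBox_subset_ball hs0 c))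
      fun u hu hq ↦ (hg u (hu.trans Set.inter_subset_left)).trans
        (mul_le_mul_of_nonneg_left (pow_le_pow_left₀ diam_nonneg (hq.1.le.trans hnμ) 2) hκ)
  have hYsi : ∀ k c, Integrable (Ys k c) E.P := fun k c ↦ by
    rw [show Ys k c = fun ω ↦ Ys k c ω from rfl]
    simp_rw [hYs]
    exact UVFarBite.integrable_finsum_inner E hE hδ (D ∩ BOX[H / 2 ^ k, c]) CTR[H / 2 ^ k, c]
      (3 * (H / 2 ^ k)) _ g (b := κ * (H / 2 ^ k) ^ 2) (by positivity)
      (Set.inter_subset_right.trans (UVFarBite.cellBox_subset_ball (by positivity) c))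
      fun u hu hq ↦ (hg u (hu.trans Set.inter_subset_left)).trans
        (mul_le_mul_of_nonneg_left (pow_le_pow_left₀ diam_nonneg hq.1.2.le 2) hκ)
  have hYμm : ∀ c, Measurable (Yμ c) := fun c ↦ by
    rw [show Yμ c = fun ω ↦ Yμ c ω from rfl]
    simp_rw [hYμ]
    exact FirstMoment.measurable_finsum_loops_sep E hE δ _ g
  have hYsm : ∀ k c, Measurable (Ys k c) := fun k c ↦ by
    rw [show Ys k c = fun ω ↦ Ys k c ω from rfl]
    simp_rw [hYs]
    exact FirstMoment.measurable_finsum_loops_sep E hE δ _ g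
  -- the mean of `S`
  have hES : ∫ ω', (∑ᶠ u ∈ {u ∈ (E.X δ ω').loops | u.range ⊆ D}, g u) ∂E.P =
      ∑ c ∈ RNG[sμ, x₀, ρ], ∫ ω', Yμ c ω' ∂E.P +
        ∑ k ∈ Finset.range n, ∑ c ∈ RNG[H / 2 ^ k, x₀, ρ], ∫ ω', Ys k c ω' ∂E.P := by
    rw [integral_congr_ae (ae_of_all _ hdec)]
    rw [integral_add (integrable_finsetSum _ fun c _ ↦ hYμi c)
      (integrable_finsetSum _ fun k _ ↦ integrable_finsetSum _ fun c _ ↦ hYsi k c),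
      integral_finsetSum _ fun c _ ↦ hYμi c,
      integral_finsetSum _ fun k _ ↦ integrable_finsetSum _ fun c _ ↦ hYsi k c]
    congr 1
    exact Finset.sum_congr rfl fun k _ ↦ integral_finsetSum _ fun c _ ↦ hYsi k c
  -- the pieces `Z`, weights `w` and exponents `B`, kept opaque
  obtain ⟨w, hw0, hwS⟩ : ∃ w : ℕ → ℝ, w 0 = 1 / 2 ∧ ∀ k, w (k + 1) = 1 / (8 * 2 ^ k) :=
    ⟨fun p ↦ Nat.rec (1 / 2) (fun k _ ↦ 1 / (8 * 2 ^ k)) p, rfl, fun _ ↦ rfl⟩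
  obtain ⟨Z, hZ0, hZS⟩ : ∃ Z : ℕ → E.Ω → ℝ,
      (∀ ω, Z 0 ω = a * ∑ c ∈ RNG[sμ, x₀, ρ], (Yμ c ω - ∫ ω', Yμ c ω' ∂E.P)) ∧
      ∀ k ω, Z (k + 1) ω = a * ∑ c ∈ RNG[H / 2 ^ k, x₀, ρ], (Ys k c ω - ∫ ω', Ys k c ω' ∂E.P) :=
    ⟨fun p ω ↦ Nat.rec (a * ∑ c ∈ RNG[sμ, x₀, ρ], (Yμ c ω - ∫ ω', Yμ c ω' ∂E.P))
      (fun k _ ↦ a * ∑ c ∈ RNG[H / 2 ^ k, x₀, ρ], (Ys k c ω - ∫ ω', Ys k c ω' ∂E.P)) p,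
      fun _ ↦ rfl, fun _ _ ↦ rfl⟩
  obtain ⟨Kμ', hKμ'⟩ : ∃ Kμ' : ℝ, Kμ' = Real.exp ((9 * (|a / (1 / 2)| * (κ * sμ ^ 2)) + 1) * M) :=
    ⟨_, rfl⟩
  obtain ⟨B, hB0, hBS⟩ : ∃ B : ℕ → ℝ,
      B 0 = 1 / 2 * (2 * (RNG[sμ, x₀, ρ]).card * (9 : ℕ) * (a / (1 / 2)) ^ 2 * (κ * sμ ^ 2) ^ 2 *
        Kμ' ^ 2) ∧
      ∀ k, B (k + 1) = 1 / (8 * 2 ^ k) * (2 * (RNG[H / 2 ^ k, x₀, ρ]).card * (9 : ℕ) *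
        (a / (1 / (8 * 2 ^ k))) ^ 2 * (κ * (H / 2 ^ k) ^ 2) ^ 2 * K ^ 2) :=
    ⟨fun p ↦ Nat.rec (1 / 2 * (2 * (RNG[sμ, x₀, ρ]).card * (9 : ℕ) * (a / (1 / 2)) ^ 2 *
        (κ * sμ ^ 2) ^ 2 * Kμ' ^ 2))
      (fun k _ ↦ 1 / (8 * 2 ^ k) * (2 * (RNG[H / 2 ^ k, x₀, ρ]).card * (9 : ℕ) *
        (a / (1 / (8 * 2 ^ k))) ^ 2 * (κ * (H / 2 ^ k) ^ 2) ^ 2 * K ^ 2)) p, rfl, fun _ ↦ rfl⟩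
  -- the microscopic piece
  have hp0 : Integrable (fun ω ↦ Real.exp (Z 0 ω / w 0)) E.P ∧
      ∫ ω, Real.exp (Z 0 ω / w 0) ∂E.P ≤ Real.exp (B 0 / w 0) := by
    have key := UVFarBite.microPiece E hE c₀ M hc₀ hM x₀ ρ κ (a / (1 / 2)) δ (H / 2 ^ n) D g hκ hδ
      hg hn_spec
    have e1 : (fun ω ↦ Real.exp (Z 0 ω / w 0)) = fun ω ↦ Real.exp (a / (1 / 2) *
        ∑ c ∈ RNG[sμ, x₀, ρ], (Yμ c ω - ∫ ω', Yμ c ω' ∂E.P)) := funext fun ω ↦ by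
      rw [hZ0, hw0, mul_div_right_comm]
    have e2 : B 0 / w 0 = 2 * (RNG[sμ, x₀, ρ]).card * (9 : ℕ) * (a / (1 / 2)) ^ 2 *
        (κ * sμ ^ 2) ^ 2 * Kμ' ^ 2 := by
      rw [hB0, hw0, mul_div_cancel_left₀ _ (by norm_num : (1 / 2 : ℝ) ≠ 0)]
    rw [e1, e2, hKμ']
    simp only [hYμ, hsμ]
    exact key
  -- the K6 pieces
  have hpS : ∀ k < n, Integrable (fun ω ↦ Real.exp (Z (k + 1) ω / w (k + 1))) E.P ∧
      ∫ ω, Real.exp (Z (k + 1) ω / w (k + 1)) ∂E.P ≤ Real.exp (B (k + 1) / w (k + 1)) := by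
    intro k hk
    have hside : 4 * c₀ * δ < H / 2 ^ k := hn_min k hk
    have hch : c₀ * δ ≤ H / 2 ^ k / 2 := by nlinarith [hδ, hc₀]
    have h2δ : 2 * δ < H / 2 ^ k := by nlinarith [hδ, hc₀]
    have hwpos : 0 < 1 / (8 * (2 : ℝ) ^ k) := by positivity
    have hl : 9 * (|a / (1 / (8 * 2 ^ k))| * (κ * (H / 2 ^ k) ^ 2)) ≤ A := by
      rw [hH]; exact (UVFarBite.order_scale_le a κ ρ hκ k).trans haA
    have key := UVFarBite.scalePiece E hE A K c₀ hK6 x₀ ρ κ a δ (H / 2 ^ k) (1 / (8 * 2 ^ k)) D g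
      hκ hδ hg hwpos hch h2δ hl
    have e1 : (fun ω ↦ Real.exp (Z (k + 1) ω / w (k + 1))) = fun ω ↦ Real.exp (a / (1 / (8 * 2 ^ k)) *
        ∑ c ∈ RNG[H / 2 ^ k, x₀, ρ], (Ys k c ω - ∫ ω', Ys k c ω' ∂E.P)) := funext fun ω ↦ by
      rw [hZS, hwS, mul_div_right_comm]
    have e2 : B (k + 1) / w (k + 1) = 2 * (RNG[H / 2 ^ k, x₀, ρ]).card * (9 : ℕ) *
        (a / (1 / (8 * 2 ^ k))) ^ 2 * (κ * (H / 2 ^ k) ^ 2) ^ 2 * K ^ 2 := by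
      rw [hBS, hwS, mul_div_cancel_left₀ _ hwpos.ne']
    rw [e1, e2]
    simp only [hYs]
    exact key
  have hpiece : ∀ p ∈ Finset.range (n + 1), Integrable (fun ω ↦ Real.exp (Z p ω / w p)) E.P ∧
      ∫ ω, Real.exp (Z p ω / w p) ∂E.P ≤ Real.exp (B p / w p) := by
    intro p hp
    cases p with
    | zero => exact hp0
    | succ k => exact hpS k (by simpa using hp)
  -- assembly across the pieces
  have hZm : ∀ p ∈ Finset.range (n + 1), Measurable (Z p) := by
    intro p _
    cases p with
    | zero =>
      rw [show Z 0 = fun ω ↦ Z 0 ω from rfl]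
      simp_rw [hZ0]
      exact (Finset.measurable_sum _ fun c _ ↦ (hYμm c).sub_const _).const_mul _
    | succ k =>
      rw [show Z (k + 1) = fun ω ↦ Z (k + 1) ω from rfl]
      simp_rw [hZS]
      exact (Finset.measurable_sum _ fun c _ ↦ (hYsm k c).sub_const _).const_mul _
  have hwpos : ∀ p ∈ Finset.range (n + 1), 0 < w p := by
    intro p _
    cases p with
    | zero => rw [hw0]; norm_num
    | succ k => rw [hwS]; positivity
  have hwsum : ∑ p ∈ Finset.range (n + 1), w p ≤ 1 := by
    rw [Finset.sum_range_succ', hw0]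
    simp_rw [hwS, UVFarBite.weight_eq, ← Finset.mul_sum]
    have := BigLoopsExp.geom_sum_range_le_two (by norm_num : (0 : ℝ) ≤ 1 / 2)
      (by norm_num : (1 / 2 : ℝ) ≤ 1 / 2) n
    linarith
  obtain ⟨hI, hle⟩ := expMoment_scaleSum_le_latticeEnsembles E hE (n + 1) Z w B hZm hwpos hwsum hpiece
  -- identification of the integrand
  have hZsum : ∀ ω, ∑ p ∈ Finset.range (n + 1), Z p ω =
      a * ((∑ᶠ u ∈ {u ∈ (E.X δ ω).loops | u.range ⊆ D}, g u) -
        ∫ ω', (∑ᶠ u ∈ {u ∈ (E.X δ ω').loops | u.range ⊆ D}, g u) ∂E.P) := by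
    intro ω
    rw [Finset.sum_range_succ', hZ0, hdec ω, hES]
    simp_rw [hZS]
    rw [← Finset.mul_sum, Finset.sum_sub_distrib]
    simp_rw [Finset.sum_sub_distrib]
    ring
  have hfun : (fun ω ↦ Real.exp (a * ((∑ᶠ u ∈ {u ∈ (E.X δ ω).loops | u.range ⊆ D}, g u) -
      ∫ ω', (∑ᶠ u ∈ {u ∈ (E.X δ ω').loops | u.range ⊆ D}, g u) ∂E.P))) =
      fun ω ↦ Real.exp (∑ p ∈ Finset.range (n + 1), Z p ω) := funext fun ω ↦ by rw [hZsum]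
  rw [hfun]
  refine ⟨hI, hle.trans (Real.exp_le_exp.2 ?_)⟩
  -- the exponents
  rw [Finset.sum_range_succ', hB0]
  simp_rw [hBS]
  have hKμ'K : Kμ' ≤ Kμ := by
    rw [hKμ', hKμ]
    refine Real.exp_le_exp.2 (mul_le_mul_of_nonneg_right ?_ (Nat.cast_nonneg M))
    rw [abs_div, abs_of_pos (by norm_num : (0 : ℝ) < 1 / 2)]
    have h1 : 9 * (|a| / (1 / 2) * (κ * sμ ^ 2)) = 288 * c₀ ^ 2 * (|a| * κ * δ ^ 2) := by
      rw [hsμ]; field_simp; ring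
    have h2 : |a| * κ * δ ^ 2 ≤ |a| * κ * ρ ^ 2 := by gcongr
    nlinarith [h1, h2, haκρ, sq_nonneg c₀]
  have hmicro := UVFarBite.exponent_micro_le (a := a) (κ := κ) (K' := Kμ') hρ hs0 (by linarith) hsρ
    (UVFarBite.card_cellRange_le hs0 x₀ hρ.le) (by rw [hKμ']; exact (Real.exp_pos _).le) hKμ'K
  have hscales : ∑ k ∈ Finset.range n, 1 / (8 * 2 ^ k) * (2 * (RNG[H / 2 ^ k, x₀, ρ]).card * (9 : ℕ) *
      (a / (1 / (8 * 2 ^ k))) ^ 2 * (κ * (H / 2 ^ k) ^ 2) ^ 2 * K ^ 2) ≤ A ^ 2 * K ^ 2 / 2 := by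
    rw [hH]
    calc ∑ k ∈ Finset.range n, 1 / (8 * 2 ^ k) * (2 * (RNG[4 * ρ / 2 ^ k, x₀, ρ]).card * (9 : ℕ) *
          (a / (1 / (8 * 2 ^ k))) ^ 2 * (κ * (4 * ρ / 2 ^ k) ^ 2) ^ 2 * K ^ 2)
        ≤ ∑ k ∈ Finset.range n, 331776 * a ^ 2 * κ ^ 2 * ρ ^ 4 * K ^ 2 * (1 / 2) ^ k :=
          Finset.sum_le_sum fun k _ ↦ UVFarBite.exponent_scale_le hρ k
            (UVFarBite.card_cellRange_le (by positivity) x₀ hρ.le)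
      _ = 331776 * a ^ 2 * κ ^ 2 * ρ ^ 4 * K ^ 2 * ∑ k ∈ Finset.range n, (1 / 2 : ℝ) ^ k := by
          rw [Finset.mul_sum]
      _ ≤ 331776 * a ^ 2 * κ ^ 2 * ρ ^ 4 * K ^ 2 * 2 :=
          mul_le_mul_of_nonneg_left (BigLoopsExp.geom_sum_range_le_two (by norm_num) (by norm_num) n)
            (by positivity)
      _ = 663552 * (|a| * κ * ρ ^ 2) ^ 2 * K ^ 2 := by
          rw [show (|a| * κ * ρ ^ 2) ^ 2 = a ^ 2 * κ ^ 2 * ρ ^ 4 by rw [mul_pow, mul_pow, sq_abs]; ring]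
          ring
      _ ≤ 663552 * (A / 1152) ^ 2 * K ^ 2 := by gcongr
      _ = A ^ 2 * K ^ 2 / 2 := by ring
  have hmicro' : 1 / 2 * (2 * (RNG[sμ, x₀, ρ]).card * (9 : ℕ) * (a / (1 / 2)) ^ 2 * (κ * sμ ^ 2) ^ 2 *
      Kμ' ^ 2) ≤ 576 * (A / 1152) ^ 2 * (c₀ ^ 2 * (2 + 8 * c₀) ^ 2) * Kμ ^ 2 :=
    hmicro.trans (by gcongr)
  linarith

end Summit.CriticalPhenomena.CardyFormulaZ2.Cruxes.NestingRigidity.PositiveConeWeightDoubling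

end
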